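import Summits.Langlands.Langlands.Theorems.IrreducibilityBySelfDualityReciprocityUpToIrreducibilityRGenericRigidityOfFactsOne
import Summits.Langlands.Langlands.Theorems.IrreducibilityBySelfDualityReciprocityUpToIrreducibilityRInvariantMeasureGLQuot
import Summits.Langlands.Langlands.Theorems.IrreducibilityBySelfDualityReciprocityUpToIrreducibilityRRigidityGlue
import Summits.Langlands.Langlands.Theorems.IrreducibilityBySelfDualityReciprocityUpToIrreducibilityRCanonicalData
import Summits.Langlands.Langlands.Theorems.IrreducibilityBySelfDualityReciprocityUpToIrreducibilityRHenniart17a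
import HarnessLib

/-!
# SKELETON — line `Sketch` (idea `henniart-rigidity-forall-rec`) for the crux
`IrreducibilityBySelfDuality.ReciprocityUpToIrreducibilityR` (item stmt-Langlands-17925),
lead prover-line-stmt-Langlands-17925-c2-0 (continuation of leads …-17925-0 and …-17925-c1-0)

R := `∀ F, Nonempty (ReciprocityData F) ∧ ∀ Rec n > 0 hcpt, (A′ for Rec) ∧ GaloisToAutomorphic n Rec hcpt`
(the REVISED summit minus irreducibility/uniqueness; open problem by design — it contains
E = `ReciprocityUpToIrreducibility`, item stmt-Langlands-14328).  The line isolates the price of the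
re-type `∃ Rec ↦ Nonempty ∧ ∀ Rec`:  R ⇐ N ∧ GenericRigidity ∧ E  (sorry-free glue, §3), where
GenericRigidity = two pinned reciprocity data agree on every GENERIC class of every rank at every
finite place (local components of cuspidal `π` are generic; the det-class relabelling of the crux's
Disproof.lean / `Negative/*` shows rigidity FAILS off the generic classes, so genericity is load-bearing).

LANDED (imported by name, namespace `…Theorems.ReciprocityUpToIrreducibilityR`):
`stub_nonempty_of_inputs` (p146901, CanonicalData), `stub_recRigidityLAlg_of_genericRigidity` /
`stub_genericRigidity_of_local` (RigidityGlue, p149072), `stub_recGL_eq_of_isSupercuspidal`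
(SupercuspidalFloor, p149520), E1/E2 (Henniart 2002 Thm 1.6 (a) elementary pair, p153326/p154770),
`stub_rigid_of_reciprocityUpToIrreducibilityR` (Tightness, p151559), S-ν
`stub_exists_invariantMeasure_glQuotient` (p158762, InvariantMeasureGLQuot — now served, IMPORTED), and
`stub_genericRigidity_of_facts_one` (p159931, GenericRigidityOfFactsOne — now served, IMPORTED): GENERIC
RIGIDITY IN ALL RANKS from five printed local inputs (`localLanglands_gl`; Harris–Taylor's correspondence
with generic preimages of indecomposable parameters; Henniart 2002 Thm 1.7 (a) Galois side; Henniart 2002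
Thm 1.6 (b) for generic `π`; invariant measures on `GL_m(F) ⧸ U_m`).

OPEN STUBS (registered; `sorry` only here): S-D `stub_exists_localEpsilonSystem_forall_isCanonical`
(Deligne 1973 Thm 4.1 at THE Artin maps = named fact `nonempty_localEpsilonSystem_isCanonical`, T0 debt),
S-LLC `stub_localLanglands_gl` (Harris–Taylor Thm A + Henniart 1993, T0 debt), S-IMG
`stub_localLanglands_gl_exists_isGeneric_preimage` (HT Thm A + Zelevinsky 9.7; Literature def p157275),
S-16b′ `stub_henniart2002_thm16b_one` (Literature def `Henniart2002_isSupercuspidal_of_forall_hasRSLFactor_one`,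
p159842; JPSS theory), S-E `stub_E` = 14328 BY NAME (open problem, never delegated).  The former leaf S-17a
`stub_henniart2002_thm17a` (Henniart 2002 Thm 1.7 (a), Galois side) is now a THEOREM (`stub_henniart2002_thm17a_holds`,
…RHenniart17a, imported), proved by this seat from two registered stubs, both LANDED:
* S-17a-A `stub_rootMultiplicity_eulerFactor_tprod_eq_finrank` (LANDED p162414, PoleOrderInvariants, imported) — the order of the pole of
  `L(s, σ ⊗ τ)` at `s = 0` (`rootMultiplicity 1` of the Euler factor) is the dimension of the
  Weil–Deligne invariants `ker N ⊓ V^{W_F}` of `σ ⊗ τ` for Frobenius-semisimple `σ, τ` (linear algebra: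
  Frobenius acts semisimply on `(ker N)^{I_F}`, so algebraic = geometric multiplicity of the eigenvalue
  `1`; `W_F = ⋃_k I_F Φ^k`);
* S-17a-B `stub_isEquivalent_of_finrank_invariants_tprod_eq` — Thm 1.7 (a) in INVARIANT FORM: a
  Frobenius-semisimple non-irreducible `σ` of dimension `n ≥ 2` is determined up to isomorphism by the
  dimensions of the Weil–Deligne invariants of `σ ⊗ τ`, `τ` indecomposable Frobenius-semisimple of
  dimension `< n` (equivalently `dim Hom_WD(τ^∨, σ)`; string decomposition of Frobenius-semisimple
  Weil–Deligne representations, Hom out of a string, segment combinatorics — Henniart's §4).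

Crux BY NAME: the farm olean of the route's Theses module still lacks `ReciprocityUpToIrreducibilityR`
(re-probed 2026-08-17T12:50Z: unknown identifier; `ReciprocityUpToIrreducibility` IS served), so the
deciding theorem `R_of` concludes the character-identical local copy `R` (registered crux decl
`Summit.Langlands.Langlands.Theorems.ReciprocityUpToIrreducibilityR.R`); swap for the route decl when served.
-/

noncomputable section

set_option linter.dupNamespace false

open scoped MatrixGroups NumberField Polynomial TensorProduct
open MeasureTheory NumberField IsDedekindDomain Filter Polynomial
open Literature.NumberTheory.Automorphic Literature.NumberTheory.GaloisRepresentations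
open Summit.Langlands

namespace Summit.Langlands.Langlands.Theorems.ReciprocityUpToIrreducibilityR

/-! ## §0 The crux, verbatim -/

/-- VERBATIM local copy of the crux decl
`Summit.Langlands.Langlands.Theses.IrreducibilityBySelfDuality.ReciprocityUpToIrreducibilityR` (route file
rev 27, item stmt-Langlands-17925); character-identical body.  Used because the farm olean of the Theses
module predates the decl. -/
def R : Prop :=
  ∀ (F : Type) [Field F] [NumberField F], Nonempty (ReciprocityData F) ∧ ∀ (Rec : ReciprocityData F) (n : ℕ), 0 < n → ∀ hcpt : Literature.NumberTheory.Automorphic.isCompact_glFiniteIntegralLevel n F, (∀ π : Literature.NumberTheory.Automorphic.CuspidalAutomorphicRepData n F hcpt, π.1.IsLAlgebraic → ∀ (ℓ : ℕ) [Fact ℓ.Prime] (ι : PadicAlgCl ℓ ≃+* ℂ), ∃ ρ : Literature.NumberTheory.GaloisRepresentations.FramedGaloisRep F (PadicAlgCl ℓ) n, IsGeometricFramed Rec ρ ∧ Corresponds Rec ι π.1 ρ) ∧ GaloisToAutomorphic n Rec hcpt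

/-- VERBATIM local copy of the support decl
`Summit.Langlands.Langlands.Theses.IrreducibilityBySelfDuality.ReciprocityUpToIrreducibility` (item
stmt-Langlands-14328, the `∃ Rec` form E); character-identical body.  PUBLICATION COPY ONLY: the registered
skeleton (work/ReciprocityUpToIrreducibilityR.lean of lead c2) states `stub_E` against the route decl by name
(served); this published copy avoids importing the Theses module, which the crux-workfile farm check reports
incoherent (2026-08-17). -/
def E : Prop :=
  ∀ (F : Type) [Field F] [NumberField F], ∃ Rec : ReciprocityData F, ∀ n : ℕ, 0 < n → ∀ hcpt : Literature.NumberTheory.Automorphic.isCompact_glFiniteIntegralLevel n F, (∀ π : Literature.NumberTheory.Automorphic.CuspidalAutomorphicRepData n F hcpt, π.1.IsLAlgebraic → ∀ (ℓ : ℕ) [Fact ℓ.Prime] (ι : PadicAlgCl ℓ ≃+* ℂ), ∃ ρ : Literature.NumberTheory.GaloisRepresentations.FramedGaloisRep F (PadicAlgCl ℓ) n, IsGeometricFramed Rec ρ ∧ Corresponds Rec ι π.1 ρ) ∧ GaloisToAutomorphic n Rec hcpt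

/-! ## §1 Leaf stubs — printed facts (T0/T1 debt) and the open problem E -/

/-- **Stub S-D (Deligne 1973, Thm 4.1 + Thm 6.5, at THE Artin maps of class field theory)** = the named
fact `nonempty_localEpsilonSystem_isCanonical` at every non-archimedean local field.
[cite: Deligne1973Constantes, Thm. 4.1 and Thm. 6.5] -/
theorem stub_exists_localEpsilonSystem_forall_isCanonical : ∀ (F : Type) [Field F] [ValuativeRel F] [TopologicalSpace F] [IsNonarchimedeanLocalField F], ∃ 𝓔 : LocalEpsilonSystem F, ∀ (E : Type) [Field E] [ValuativeRel E] [TopologicalSpace E] [IsNonarchimedeanLocalField E] [Algebra F E] [FiniteDimensional F E], (𝓔.artin E).IsCanonical := by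
  sorry

/-- **Stub S-LLC (Harris–Taylor 2001 Thm A; Henniart 2000; uniqueness Henniart 1993 Thm 1.1)** = the named
fact `localLanglands_gl` for every non-archimedean local field and every normalising pair.
[cite: HarrisTaylorAMS2001, Thm. A] [cite: Henniarts1993, Thm 1.1] -/
theorem stub_localLanglands_gl : ∀ (F : Type) [Field F] [ValuativeRel F] [TopologicalSpace F] [IsNonarchimedeanLocalField F] (hmul : @IsFrobPow.mul F _ _ _ _) (huniq : @IsFrobPow.unique F _ _ _ _) (hn : absInertia_normal F) (hex : @exists_isFrobPow F _ _ _ _) (hns : @WeilGroup.exists_subgroup_le_inertia_isOpen_of_continuous F _ _ _ _) (d : LocalArtinData F) (𝓔 : LocalEpsilonSystem F) (hd : 𝓔.artin F = d), localLanglands_gl F hmul huniq hn hex hns d 𝓔 hd := by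
  sorry

/-- **Stub S-IMG (Harris–Taylor 2001 Thm A with Zelevinsky 1980, 9.3/9.7; Henniart 2002 §2.6–2.9)**: for the
canonical normalising pair there is a six-clause family under which every indecomposable
Frobenius-semisimple parameter is the parameter of a representation generic for every `ψ` (= the named
fact `localLanglands_gl_exists_isGeneric_preimage`, Literature proposal p157275).
[cite: HarrisTaylorAMS2001, Thm. A] [cite: HenniartBSMF2002, §2.6–2.9] [cite: Zelevinsky1980, Thm. 9.7] -/
theorem stub_localLanglands_gl_exists_isGeneric_preimage : ∀ (F : Type) [Field F] [ValuativeRel F] [TopologicalSpace F] [IsNonarchimedeanLocalField F] (hmul : @IsFrobPow.mul F _ _ _ _) (huniq : @IsFrobPow.unique F _ _ _ _) (hn : absInertia_normal F) (hex : @exists_isFrobPow F _ _ _ _) (hns : @WeilGroup.exists_subgroup_le_inertia_isOpen_of_continuous F _ _ _ _) (d : LocalArtinData F) (𝓔 : LocalEpsilonSystem F), 𝓔.artin F = d → (∀ (E : Type) [Field E] [ValuativeRel E] [TopologicalSpace E] [IsNonarchimedeanLocalField E] [Algebra F E] [FiniteDimensional F E], (𝓔.artin E).IsCanonical) → ∃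 rec : ∀ n : ℕ, IrrClass (GL (Fin n) F) → Quotient (frobSemisimpleWDSetoid F n), IsLocalLanglandsGL F hmul huniq hn hex hns d 𝓔 rec ∧ ∀ (n : ℕ), 0 < n → ∀ (φ : WeilDeligneRep F ℂ (Fin n → ℂ)) (hφ : φ.IsFrobSemisimple), φ.IsIndecomposable → ∃ π : SmoothIrrep (GL (Fin n) F), (∀ ψ : AddChar F Circle, ψ.IsContinuousNontrivial → IsGeneric π.ρ ψ) ∧ rec n (IrrClass.mk π) = Quotient.mk (frobSemisimpleWDSetoid F n) ⟨φ, hφ⟩ := by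
  sorry

/-- **Stub S-16b′ (Henniart 2002, Thm 1.6 (b), (ii) ⇒ (i), for generic `π`, EXISTENCE-INCLUDED form; JPSS 1983)** =
the named fact `Henniart2002_isSupercuspidal_of_forall_hasRSLFactor_one` (Literature, appended by p159842; weaker than
the `… → P = 1` form `…_eq_one` of p157277, which implies it by `HasRSLFactor.unique`) at every non-archimedean local
field. [cite: HenniartBSMF2002, Thm. 1.6 (b)] -/
theorem stub_henniart2002_thm16b_one : ∀ (F : Type) [Field F] [ValuativeRel F] [TopologicalSpace F] [IsNonarchimedeanLocalField F] (n : ℕ), 2 ≤ n → ∀ (π : SmoothIrrep (GL (Fin n) F)), (∃ ψ : AddChar F Circle, ψ.IsContinuousNontrivial ∧ IsGeneric π.ρ ψ) → (∀ (ψ : AddChar F Circle), ψ.IsContinuousNontrivial → IsGeneric π.ρ ψ → ∀ (r : ℕ), 0 < r → ∀ (hrn : r < n) (ρ : SmoothIrrep (GL (Fin r) F)), ρ.ρ.IsSupercuspidal → IsGeneric ρ.ρ ψ⁻¹ → ∀ [MeasurableSpace (GL (Fin r) F ⧸ upperUnitriangular (Fin r) F)] [BorelSpace (GL (Fin r) F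 ⧸ upperUnitriangular (Fin r) F)] (ν : Measure (GL (Fin r) F ⧸ upperUnitriangular (Fin r) F)) [SMulInvariantMeasure (GL (Fin r) F) (GL (Fin r) F ⧸ upperUnitriangular (Fin r) F) ν] [IsFiniteMeasureOnCompacts ν] [ν.IsOpenPosMeasure], HasRSLFactor hrn π.ρ ρ.ρ ψ ν 1) → π.ρ.IsSupercuspidal := by
  sorry

/-- **Stub S-E (OPEN PROBLEM, registered, never delegated)**: the `∃ Rec` form E = item stmt-Langlands-14328
BY NAME, i.e. the route decl `Summit.Langlands.Langlands.Theses.IrreducibilityBySelfDuality.ReciprocityUpToIrreducibility`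
(Buzzard–Gee Conj. 3.2.1 minus irreducibility + Fontaine–Mazur–Langlands, all `n`, all `F`).
[cite: BuzzardGeeLMS2014, Conj. 3.2.1 and Conj. 3.2.2] [cite: FontaineMazurGeometric1995, Conj. 1] -/
theorem stub_E : E := by
  sorry

/-! ## §1b Henniart 2002 Thm 1.7 (a) (former leaf S-17a): LANDED — S-17a-A (p162414 PoleOrderInvariants) +
S-17a-B (Henniart17a) + discharge `stub_henniart2002_thm17a_holds` (both in Henniart17a), imported by name -/

/-! ## §2 Generic rigidity (LANDED p159931, composed with the leaves) -/

/-- **GenericRigidity, all ranks**: two pinned reciprocity data agree on every generic class of every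
completion (the landed `stub_genericRigidity_of_facts_one` fed by S-LLC, S-IMG, S-17a (now §1b), S-16b′, S-ν).
[cite: HenniartBSMF2002, Thm. 1.6 (b) and Thm. 1.7 (a)] -/
theorem genericRigidity : ∀ (K : Type) [Field K] [NumberField K] (Rec Rec' : ReciprocityData K) (v : HeightOneSpectrum (𝓞 K)) (n : ℕ) (πv : SmoothIrrep (GL (Fin n) (v.adicCompletion K))) (ψ : AddChar (v.adicCompletion K) Circle), ψ.IsContinuousNontrivial → IsGeneric πv.ρ ψ → (Rec.llc v).recGL n (IrrClass.mk πv) = (Rec'.llc v).recGL n (IrrClass.mk πv) :=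
  stub_genericRigidity_of_facts_one stub_localLanglands_gl stub_localLanglands_gl_exists_isGeneric_preimage
    stub_henniart2002_thm17a_holds stub_henniart2002_thm16b_one stub_exists_invariantMeasure_glQuotient

/-- **Rigidity on local components of L-algebraic cuspidal `π`** (landed glue G1 + `genericRigidity`).
[cite: Shalika1974, Thm 5.5] -/
theorem recRigidityLAlg :
    ∀ (K : Type) [Field K] [NumberField K] (Rec Rec' : ReciprocityData K) (n : ℕ)
      (hcpt : isCompact_glFiniteIntegralLevel n K), 0 < n →
      ∀ (π : CuspidalAutomorphicRepData n K hcpt), π.1.IsLAlgebraic →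
        ∀ (v : HeightOneSpectrum (𝓞 K)) (πv : SmoothIrrep (GL (Fin n) (v.adicCompletion K))),
          π.1.HasLocalComponentAt v πv.ρ →
            (Rec.llc v).recGL n (IrrClass.mk πv) = (Rec'.llc v).recGL n (IrrClass.mk πv) :=
  stub_recRigidityLAlg_of_genericRigidity genericRigidity

/-! ## §3 Glue: datum transport and the collapse R ⇐ N ∧ rigidity ∧ E (sorry-free) -/

/-- `IsGeometricFramed` does not depend on `Rec` (the `p`-adic Hodge datum is pinned). [folklore] -/
theorem isGeometricFramed_iff {K : Type} [Field K] [NumberField K] (Rec Rec' : ReciprocityData K)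
    {ℓ : ℕ} [Fact ℓ.Prime] {n : ℕ} (ρ : FramedGaloisRep K (PadicAlgCl ℓ) n) :
    IsGeometricFramed Rec ρ ↔ IsGeometricFramed Rec' ρ :=
  Iff.rfl

/-- **Transport of `Corresponds` along rigid data** for L-algebraic cuspidal `π`: the datum enters only
through `(Rec.llc v).recGL n [π_v]` at a local component. [folklore] -/
theorem corresponds_transport {K : Type} [Field K] [NumberField K] (Rec Rec' : ReciprocityData K)
    {n : ℕ} (hn : 0 < n) {hcpt : isCompact_glFiniteIntegralLevel n K}
    (π : CuspidalAutomorphicRepData n K hcpt) (hπ : π.1.IsLAlgebraic)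
    {ℓ : ℕ} [Fact ℓ.Prime] (ι : PadicAlgCl ℓ ≃+* ℂ) (ρ : FramedGaloisRep K (PadicAlgCl ℓ) n)
    (h : Corresponds Rec ι π.1 ρ) : Corresponds Rec' ι π.1 ρ := by
  refine ⟨h.1, fun v => ?_⟩
  obtain ⟨πv, r, rℂ, hloc, haway, habove, htrans, hclass⟩ := h.2 v
  refine ⟨πv, r, rℂ, hloc, haway, habove, htrans, ?_⟩
  rw [← recRigidityLAlg K Rec Rec' n hcpt hn π hπ v πv hloc]
  exact hclass

/-- **Non-vacuity** `∀ F, Nonempty (ReciprocityData F)` (landed `stub_nonempty_of_inputs` fed by S-D, S-LLC).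
[cite: HarrisTaylorAMS2001, Thm. A] -/
theorem nonempty_reciprocityData : ∀ (F : Type) [Field F] [NumberField F], Nonempty (ReciprocityData F) :=
  stub_nonempty_of_inputs stub_exists_localEpsilonSystem_forall_isCanonical
    (fun F _ _ _ _ hmul huniq hn hex hns d 𝓔 hd => stub_localLanglands_gl F hmul huniq hn hex hns d 𝓔 hd)

/-- **The crux BY NAME (local copy `R`) from the registered stubs**: N (S-D, S-LLC) ∧ GenericRigidity
(S-LLC, S-IMG, S-17a-A/B, S-16b′, S-ν through p159931) ∧ E (S-E). -/
theorem R_of : R := by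
  intro F _ _
  refine ⟨nonempty_reciprocityData F, fun Rec n hn hcpt => ?_⟩
  obtain ⟨Rec₀, h₀⟩ := stub_E F
  obtain ⟨hA, hB⟩ := h₀ n hn hcpt
  refine ⟨fun π hπ ℓ _ ι => ?_, fun ℓ _ ι ρ hirr hgeo => ?_⟩
  · obtain ⟨ρ, hgeo, hcorr⟩ := hA π hπ ℓ ι
    exact ⟨ρ, (isGeometricFramed_iff Rec₀ Rec ρ).1 hgeo, corresponds_transport Rec₀ Rec hn π hπ ι ρ hcorr⟩
  · obtain ⟨π, hπ, hcorr⟩ := hB ℓ ι ρ hirr ((isGeometricFramed_iff Rec Rec₀ ρ).1 hgeo)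
    exact ⟨π, hπ, corresponds_transport Rec₀ Rec hn π hπ ι ρ hcorr⟩

end Summit.Langlands.Langlands.Theorems.ReciprocityUpToIrreducibilityR

end
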